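import Literature.NumberTheory.Automorphic.BorelStabilizerCohomology
import Mathlib.LinearAlgebra.FiniteDimensional.Lemmas
import HarnessLib

/-!
# The eigen-coordinates `θ_τ = τ ∘ β` of the Borel stabilisers of a quadratic field

Topic `NumberTheory/Automorphic`; namespace `Literature.NumberTheory.Automorphic.ParallelWeight`.
Definitions with bodies and theorems (no named fact); imports `BorelStabilizerCohomology` + Mathlib.

For the stabiliser `Λ = Γ_{x₀} ≤ B(F)` of a boundary point at a neat level (`borelStabilizer`, whose
elements are the unipotent `n(β)` with `β` in a box, `BorelStabilizerCohomology`):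

* `urEntry`, `urEntry_mul` — the additive coordinate `β : Λ → F`, `γ = n(β(γ))`;
* `thetaChar τ = τ ∘ β : Λ → E` — the additive characters through the embeddings `τ : F → E`;
* `urEntry_conj` — for diagonal `s = diag(a, b) ∈ B(F)`: `β(s⁻¹ γ s) = β(γ) b / a`, so that
  `θ_τ ∘ c_s = τ(b/a) θ_τ` (the eigen-coordinate property used by
  `Literature.Algebra.Homology.RankTwoLatticeCohomologyCharacters`);
* `thetaChar_indep` — for a quadratic `F` and `τ₁ ≠ τ₂`, `θ_{τ₁}, θ_{τ₂}` are not proportional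
  (the box contains a `ℚ`-basis of `F`).

These are the data computing the torus eigencharacters `1, τᵢ(b/a), τ₁τ₂(b/a)` on `H^•(Λ, E)`
[Harder1987, §2, (2.4)–(2.7)].

## References

* G. Harder, *Eisenstein cohomology of arithmetic groups. The case GL₂*, Invent. Math. 89 (1987), §2.
  [Harder1987]
-/

noncomputable section

open scoped NumberField
open IsDedekindDomain

namespace Literature.NumberTheory.Automorphic.ParallelWeight

section Lattice

open BigHeckeGLn GLnCohomology

variable {F : Type} [Field F] [NumberField F] {E : Type} [Field E]
  {𝔫 : Ideal (𝓞 F)}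
  (hneat : ∀ a : F, (∀ v : HeightOneSpectrum (𝓞 F), v.valuation F a ≤ 1) →
    (∀ v : HeightOneSpectrum (𝓞 F), v.valuation F a⁻¹ ≤ 1) →
    (∀ v : HeightOneSpectrum (𝓞 F), v.valuation F (a - 1) ≤ idealRadius F v 𝔫) → a = 1)
  (t : Fin 2 → (FiniteAdeleRing (𝓞 F) F)ˣ) {c : FiniteAdelicGL 2 F}
  (hc : c ∈ glFiniteIntegralLevel 2 F)

/-! ### The additive coordinate `β : Λ → F` and the characters `θ_τ = τ ∘ β` -/

/-- The upper right entry `β(γ)` of `γ = n(β) ∈ Λ`. [folklore] -/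
def urEntry (γ : borelStabilizer 𝔫 t c) : F :=
  (((γ : borel F) : GL (Fin 2) F) : Matrix (Fin 2) (Fin 2) F) 0 1

include hneat hc in
/-- `γ = n(β(γ))`. [cite: Harder1987, §2] -/
theorem coe_eq_upperRightHom_urEntry (γ : borelStabilizer 𝔫 t c) :
    ((γ : borel F) : GL (Fin 2) F) = Matrix.GeneralLinearGroup.upperRightHom (urEntry t γ) :=
  (coe_eq_upperRightHom_of_mem_borelStabilizer hneat t hc γ).1

include hneat hc in
/-- `β` is additive: `β(γ γ') = β(γ) + β(γ')`. [folklore] -/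
theorem urEntry_mul (γ γ' : borelStabilizer 𝔫 t c) : urEntry t (γ * γ') = urEntry t γ + urEntry t γ' := by
  have h1 : (((γ * γ' : borelStabilizer 𝔫 t c) : borel F) : GL (Fin 2) F) =
      Matrix.GeneralLinearGroup.upperRightHom (urEntry t γ + urEntry t γ') := by
    rw [AddChar.map_add_eq_mul, ← coe_eq_upperRightHom_urEntry hneat t hc γ,
      ← coe_eq_upperRightHom_urEntry hneat t hc γ']
    rfl
  show ((((γ * γ' : borelStabilizer 𝔫 t c) : borel F) : GL (Fin 2) F) : Matrix (Fin 2) (Fin 2) F) 0 1 = _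
  rw [h1]
  simp [Matrix.GeneralLinearGroup.upperRightHom_apply]

include hneat hc in
/-- `β(1) = 0`. [folklore] -/
theorem urEntry_one : urEntry t (1 : borelStabilizer 𝔫 t c) = 0 := by
  have := urEntry_mul hneat t hc (1 : borelStabilizer 𝔫 t c) 1
  rw [mul_one] at this
  exact add_eq_left.1 this.symm

/-- **The additive character `θ_τ = τ ∘ β : Λ → E`** of an embedding `τ`. [cite: Harder1987, §2] -/
def thetaChar (τ : F →+* E) : Additive (borelStabilizer 𝔫 t c) →+ E :=
  { toFun := fun γ => τ (urEntry t γ.toMul)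
    map_zero' := by
      change τ (urEntry t (1 : borelStabilizer 𝔫 t c)) = 0
      rw [urEntry_one hneat t hc, map_zero]
    map_add' := fun γ γ' => by
      change τ (urEntry t (γ.toMul * γ'.toMul)) = τ (urEntry t γ.toMul) + τ (urEntry t γ'.toMul)
      rw [urEntry_mul hneat t hc, map_add] }

/-- Unfolding `thetaChar`. [folklore] -/
@[simp]
theorem thetaChar_apply (τ : F →+* E) (γ : borelStabilizer 𝔫 t c) :
    thetaChar hneat t hc τ (Additive.ofMul γ) = τ (urEntry t γ) := rfl

/-! ### Conjugation by a diagonal element multiplies `β` by `b/a` -/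

include hneat hc in
/-- For diagonal `s = diag(a, b) ∈ B(F)` and `γ ∈ Λ` with `s⁻¹ γ s ∈ Λ`: `β(s⁻¹ γ s) = β(γ) · b / a`.
[cite: Harder1987, §2] -/
theorem urEntry_conj (s : borel F) (hs01 : ((s : GL (Fin 2) F) : Matrix (Fin 2) (Fin 2) F) 0 1 = 0)
    (γ : borelStabilizer 𝔫 t c) (hmem : s⁻¹ * (γ : borel F) * s ∈ borelStabilizer 𝔫 t c) :
    urEntry t (⟨s⁻¹ * (γ : borel F) * s, hmem⟩ : borelStabilizer 𝔫 t c) =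
      urEntry t γ * (((s : GL (Fin 2) F) : Matrix (Fin 2) (Fin 2) F) 1 1 /
        ((s : GL (Fin 2) F) : Matrix (Fin 2) (Fin 2) F) 0 0) := by
  set a := ((s : GL (Fin 2) F) : Matrix (Fin 2) (Fin 2) F) 0 0 with ha'
  set b := ((s : GL (Fin 2) F) : Matrix (Fin 2) (Fin 2) F) 1 1 with hb'
  -- `a ≠ 0` from `det s = a b ≠ 0`
  have ha : a ≠ 0 := by
    have hdet : ((s : GL (Fin 2) F) : Matrix (Fin 2) (Fin 2) F).det ≠ 0 := by
      rw [← Matrix.GeneralLinearGroup.val_det_apply]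
      exact Units.ne_zero _
    rw [Matrix.det_fin_two, hs01, zero_mul, sub_zero] at hdet
    exact left_ne_zero_of_mul hdet
  -- `s · (s⁻¹ γ s) = γ · s`, compare the entries `(0, 1)`
  set u : borelStabilizer 𝔫 t c := ⟨s⁻¹ * (γ : borel F) * s, hmem⟩ with hu'
  have hu : (s : GL (Fin 2) F) * ((u : borel F) : GL (Fin 2) F) = ((γ : borel F) : GL (Fin 2) F) * (s : GL (Fin 2) F) := by
    have h1 : ((u : borel F) : GL (Fin 2) F) = (s : GL (Fin 2) F)⁻¹ * ((γ : borel F) : GL (Fin 2) F) * (s : GL (Fin 2) F) := by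
      rw [hu']
      rfl
    rw [h1, ← mul_assoc, ← mul_assoc, mul_inv_cancel, one_mul]
  have hmat := congrArg (fun g : GL (Fin 2) F => (g : Matrix (Fin 2) (Fin 2) F) 0 1) hu
  simp only [Matrix.GeneralLinearGroup.coe_mul, Matrix.mul_apply, Fin.sum_univ_two] at hmat
  rw [coe_eq_upperRightHom_urEntry hneat t hc u, coe_eq_upperRightHom_urEntry hneat t hc γ] at hmat
  simp only [Matrix.GeneralLinearGroup.upperRightHom_apply, Matrix.of_apply, Matrix.cons_val',
    Matrix.cons_val_zero, Matrix.cons_val_one, Matrix.empty_val', Matrix.cons_val_fin_one, hs01] at hmat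
  have hmat' : a * urEntry t u = urEntry t γ * b := by rw [hb']; linear_combination hmat
  field_simp
  linear_combination hmat'

/-! ### The two eigen-coordinates are independent -/

omit [NumberField F] in
/-- `ℤ`-independent `b₀, b₁` are `ℚ`-independent. [folklore] -/
theorem linearIndependent_pair_of_int {b₀ b₁ : F}
    (hind : ∀ m₀ m₁ : ℤ, (m₀ : F) * b₀ + (m₁ : F) * b₁ = 0 → m₀ = 0 ∧ m₁ = 0) [CharZero F] :
    LinearIndependent ℚ ![b₀, b₁] := by
  rw [LinearIndependent.pair_iff]
  intro s t' hst
  -- clear denominators with `N = s.den * t'.den`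
  have key : ((s.num * t'.den : ℤ) : F) * b₀ + ((t'.num * s.den : ℤ) : F) * b₁ = 0 := by
    have h := congrArg (fun y : F => ((s.den * t'.den : ℕ) : ℚ) • y) hst
    simp only [smul_zero, smul_add, smul_smul] at h
    have e1 : ((s.den * t'.den : ℕ) : ℚ) * s = ((s.num * t'.den : ℤ) : ℚ) := by
      rw [Nat.cast_mul, Int.cast_mul, Int.cast_natCast, mul_comm (s.den : ℚ), mul_assoc, Rat.den_mul_eq_num,
        mul_comm]
    have e2 : ((s.den * t'.den : ℕ) : ℚ) * t' = ((t'.num * s.den : ℤ) : ℚ) := by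
      rw [Nat.cast_mul, Int.cast_mul, Int.cast_natCast, mul_assoc, Rat.den_mul_eq_num, mul_comm]
    rw [e1, e2, Rat.smul_def, Rat.smul_def, Rat.cast_intCast, Rat.cast_intCast] at h
    exact h
  obtain ⟨h0, h1⟩ := hind _ _ key
  have hs : s.num = 0 := by
    rcases mul_eq_zero.1 h0 with h | h
    · exact h
    · exact absurd h (Int.natCast_ne_zero.2 t'.den_nz)
  have ht : t'.num = 0 := by
    rcases mul_eq_zero.1 h1 with h | h
    · exact h
    · exact absurd h (Int.natCast_ne_zero.2 s.den_nz)
  exact ⟨Rat.zero_of_num_zero hs, Rat.zero_of_num_zero ht⟩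

include hneat hc in
/-- **The eigen-coordinates `θ_{τ₁}, θ_{τ₂}` (`τ₁ ≠ τ₂`) are not proportional** on the rank-two
stabiliser of a quadratic field. [cite: Harder1987, §2] -/
theorem thetaChar_indep [CharZero E] (hF : Module.finrank ℚ F = 2) (h𝔫 : 𝔫 ≠ 0) {τ₁ τ₂ : F →+* E}
    (hτ : τ₁ ≠ τ₂) (a b : E)
    (h : ∀ γ : borelStabilizer 𝔫 t c,
      a * thetaChar hneat t hc τ₁ (Additive.ofMul γ) + b * thetaChar hneat t hc τ₂ (Additive.ofMul γ) = 0) :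
    a = 0 ∧ b = 0 := by
  obtain ⟨b₀, b₁, hb₀, hb₁, -, hind⟩ := exists_two_generators_borelBox hF h𝔫 t
  -- the `ℚ`-linear functional `ℓ = a τ₁ + b τ₂`
  set ℓ₀ : F →+ E := a • (τ₁ : F →+* E).toAddMonoidHom + b • (τ₂ : F →+* E).toAddMonoidHom with hℓ₀
  have hℓ₀_apply : ∀ y : F, ℓ₀ y = a * τ₁ y + b * τ₂ y := fun y => rfl
  set ℓ : F →ₗ[ℚ] E := ℓ₀.toRatLinearMap with hℓ
  have hℓ_apply : ∀ y : F, ℓ y = a * τ₁ y + b * τ₂ y := fun y => rfl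
  -- `ℓ` vanishes on `b₀, b₁ ∈ box` (as `n(bⱼ) ∈ Λ`)
  have hvan : ∀ β ∈ borelBox 𝔫 t, ℓ β = 0 := by
    intro β hβ
    have hγ := h (borelStabilizerElt t (upperRightHom_mem_borelStabilizer hneat t hc hβ))
    rw [thetaChar_apply, thetaChar_apply] at hγ
    have hur : urEntry t (borelStabilizerElt t (upperRightHom_mem_borelStabilizer hneat t hc hβ)) = β := by
      simp [urEntry, borelStabilizerElt, Matrix.GeneralLinearGroup.upperRightHom_apply]
    rw [hur] at hγ
    rw [hℓ_apply, hγ]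
  -- hence on all of `F` (`b₀, b₁` a `ℚ`-basis)
  have hli := linearIndependent_pair_of_int hind
  have hspan : Submodule.span ℚ (Set.range ![b₀, b₁]) = ⊤ :=
    hli.span_eq_top_of_card_eq_finrank' (by rw [Fintype.card_fin, hF])
  have hℓ0 : ℓ = 0 := by
    refine LinearMap.ext_on_range hspan fun i => ?_
    rw [LinearMap.zero_apply]
    fin_cases i
    · exact hvan b₀ hb₀
    · exact hvan b₁ hb₁
  have h1 : a + b = 0 := by
    have := LinearMap.congr_fun hℓ0 1
    rwa [hℓ_apply, map_one, map_one, mul_one, mul_one, LinearMap.zero_apply] at this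
  obtain ⟨y, hy⟩ : ∃ y : F, τ₁ y ≠ τ₂ y := by
    by_contra hall
    push Not at hall
    exact hτ (RingHom.ext hall)
  have h2 : a * τ₁ y + b * τ₂ y = 0 := by
    have := LinearMap.congr_fun hℓ0 y
    rwa [hℓ_apply, LinearMap.zero_apply] at this
  have hb' : b = -a := by linear_combination h1
  rw [hb'] at h2
  have ha : a = 0 := by
    have : a * (τ₁ y - τ₂ y) = 0 := by linear_combination h2
    rcases mul_eq_zero.1 this with h | h
    · exact h
    · exact absurd (sub_eq_zero.1 h) hy
  exact ⟨ha, by rw [hb', ha, neg_zero]⟩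

end Lattice

end Literature.NumberTheory.Automorphic.ParallelWeight
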